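import Mathlib
import HarnessLib
import Summits.CriticalPhenomena.PercolationContinuityZ3.Theses.PercLayerChain
import Summits.CriticalPhenomena.PercolationContinuityZ3.Theorems.PercLayerChainShadowTransport
import Literature.Probability.Percolation.HalfSpacePinnedPairs

/-!
# `SectionRatioMoment → ShadowReciprocity` (route `PercLayerChain`, item `MomentGivesReciprocity`)

Item `stmt-CriticalPhenomena-5753` (`MomentGivesReciprocity`, support, rank 9) of route
`CriticalPhenomena/PercLayerChain`. Bond percolation on `ℤ³` at `p_c`, `ℍ = {x | 0 ≤ x₀}`,
`y_t = (t,0,0)`, `s_t = P(y_t ↔ ∂ℍ in ℍ)` (shadow density), `π_t = P(0 ↔ {x₀ = t} in ℍ)`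
(wall-to-height-`t` arm), `D_t`, `W` the height-`t` and floor sections of the wall cluster of the
origin. If `E[(D_t/W)^q] ≤ C` for some `q > 1` and all `t ≥ 1` (`SectionRatioMoment`), then
`s_t ≤ C' π_t^a` with `a = 1 - 1/q > 0` and `C' = max(C,0)^{1/q}` (`ShadowReciprocity`).

## Proof

By the shadow transport identity `s_t = ∫ D_t/W dP` (item `ShadowTransport`, proved in
`PercLayerChainShadowTransport.lean`: mass transport + Barsky–Grimmett–Newman) and
`D_t/W = (D_t/W) · 𝟙{D_t ≠ ∅}`, Hölder's inequality with the conjugate exponents `q` and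
`(1 - 1/q)⁻¹` (`ENNReal.lintegral_mul_le_Lp_mul_Lq`) gives, in `ℝ≥0∞`,
`P(shadow) ≤ (∫ (D_t/W)^q)^{1/q} · π_t^{1 - 1/q} ≤ (ofReal C)^{1/q} · π_t^{1 - 1/q}`,
and everything is finite, so the same holds for `Measure.real` and real powers. The Hölder step
(`lintegral_ratio_le_holder`) is stated for an arbitrary measure, region `H` and level `l`.

Sources: R. Lyons – Y. Peres, *Probability on Trees and Networks* (2016), §8.2 (mass transport);
G. Grimmett, *Percolation* (1999), Thm. (7.35); Hölder's inequality (Mathlib).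
-/

noncomputable section

namespace Summit.CriticalPhenomena.PercolationContinuityZ3.Theorems

open MeasureTheory Literature.Probability.Percolation Literature.Probability.LatticeModels
open scoped ENNReal

namespace MomentGivesReciprocity

variable {H : Set (Site 3)}

/-! ## Measurability -/

/-- `ω ↦ 𝟙{v₀ = l, 0 ↔ v in H}` is measurable. [folklore] -/
theorem measurable_mem_section (l : ℤ) (v : Site 3) :
    Measurable fun ω : BondConfig (Site 3) => v ∈ {v : Site 3 | v 0 = l ∧ ω ∈ openConnIn H 0 v} :=
  measurable_const.and (measurableSet_openConnIn_of_countable _ 0 v).mem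

/-- The event `{0 ↔ {x₀ = l} in H}` (the level-`l` section is non-empty) is measurable.
[folklore] -/
theorem measurableSet_reach (l : ℤ) :
    MeasurableSet {ω' : BondConfig (Site 3) | ∃ y : Site 3, y 0 = l ∧ ω' ∈ openConnIn H 0 y} :=
  measurableSet_setOf.2 (Measurable.exists fun y => measurable_mem_section l y)

/-- The section ratio `ω ↦ D(ω)/W(ω)` (level-`l` over floor section of the `H`-cluster of the
origin, as `ENNReal.ofReal` of the real quotient of `Set.ncard`s) is measurable. [folklore] -/
theorem measurable_ratio (l : ℤ) :
    Measurable fun ω : BondConfig (Site 3) =>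
      ENNReal.ofReal (({v : Site 3 | v 0 = l ∧ ω ∈ openConnIn H 0 v}.ncard : ℝ) /
        ({v : Site 3 | v 0 = 0 ∧ ω ∈ openConnIn H 0 v}.ncard : ℝ)) := by
  refine ENNReal.measurable_ofReal.comp (Measurable.div ?_ ?_)
  · exact (Measurable.of_discrete (f := fun n : ℕ => (n : ℝ))).comp
      (measurable_ncard.comp (measurable_set_iff.2 (measurable_mem_section l)))
  · exact (Measurable.of_discrete (f := fun n : ℕ => (n : ℝ))).comp
      (measurable_ncard.comp (measurable_set_iff.2 (measurable_mem_section 0)))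

/-! ## Hölder -/

/-- The section ratio vanishes off the event that the level-`l` section is non-empty:
`D/W = (D/W) · 𝟙{D ≠ ∅}`. [folklore] -/
theorem ratio_eq_ratio_mul_indicator (l : ℤ) (ω : BondConfig (Site 3)) :
    ENNReal.ofReal (({v : Site 3 | v 0 = l ∧ ω ∈ openConnIn H 0 v}.ncard : ℝ) /
        ({v : Site 3 | v 0 = 0 ∧ ω ∈ openConnIn H 0 v}.ncard : ℝ)) =
      ENNReal.ofReal (({v : Site 3 | v 0 = l ∧ ω ∈ openConnIn H 0 v}.ncard : ℝ) /
          ({v : Site 3 | v 0 = 0 ∧ ω ∈ openConnIn H 0 v}.ncard : ℝ)) *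
        {ω' : BondConfig (Site 3) | ∃ y : Site 3, y 0 = l ∧ ω' ∈ openConnIn H 0 y}.indicator
          (1 : BondConfig (Site 3) → ℝ≥0∞) ω := by
  by_cases h : ω ∈ {ω' : BondConfig (Site 3) | ∃ y : Site 3, y 0 = l ∧ ω' ∈ openConnIn H 0 y}
  · rw [Set.indicator_of_mem h, Pi.one_apply, mul_one]
  · rw [Set.indicator_of_notMem h, mul_zero]
    have hD : {v : Site 3 | v 0 = l ∧ ω ∈ openConnIn H 0 v} = ∅ :=
      Set.eq_empty_of_forall_notMem fun v hv => h ⟨v, hv⟩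
    rw [hD, Set.ncard_empty, Nat.cast_zero, zero_div, ENNReal.ofReal_zero]

/-- A positive power of the indicator of an event is the indicator. [folklore] -/
theorem indicator_one_rpow (A : Set (BondConfig (Site 3))) {r : ℝ} (hr : 0 < r)
    (ω : BondConfig (Site 3)) :
    (A.indicator (1 : BondConfig (Site 3) → ℝ≥0∞) ω) ^ r = A.indicator 1 ω := by
  by_cases h : ω ∈ A
  · rw [Set.indicator_of_mem h, Pi.one_apply, ENNReal.one_rpow]
  · rw [Set.indicator_of_notMem h, ENNReal.zero_rpow_of_pos hr]

/-- **Hölder step** (in `ℝ≥0∞`, any measure `μ`): for `q > 1`,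
`∫ D/W dμ ≤ (∫ (D/W)^q dμ)^{1/q} · μ(D ≠ ∅)^{1 - 1/q}`, from `D/W = (D/W)𝟙{D ≠ ∅}` and Hölder
with the conjugate exponents `q`, `(1 - 1/q)⁻¹`. [folklore] -/
theorem lintegral_ratio_le_holder (μ : Measure (BondConfig (Site 3))) (l : ℤ) {q : ℝ} (hq : 1 < q) :
    ∫⁻ ω, ENNReal.ofReal (({v : Site 3 | v 0 = l ∧ ω ∈ openConnIn H 0 v}.ncard : ℝ) /
        ({v : Site 3 | v 0 = 0 ∧ ω ∈ openConnIn H 0 v}.ncard : ℝ)) ∂μ ≤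
      (∫⁻ ω, ENNReal.ofReal ((({v : Site 3 | v 0 = l ∧ ω ∈ openConnIn H 0 v}.ncard : ℝ) /
          ({v : Site 3 | v 0 = 0 ∧ ω ∈ openConnIn H 0 v}.ncard : ℝ)) ^ q) ∂μ) ^ (1 / q) *
        (μ {ω' : BondConfig (Site 3) | ∃ y : Site 3, y 0 = l ∧ ω' ∈ openConnIn H 0 y}) ^ (1 - q⁻¹) := by
  have hq0 : 0 < q := lt_trans zero_lt_one hq
  have ha : 0 < 1 - q⁻¹ := by
    have : q⁻¹ < 1 := inv_lt_one_of_one_lt₀ hq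
    linarith
  have hpq : q.HolderConjugate (1 - q⁻¹)⁻¹ :=
    Real.holderConjugate_iff.2 ⟨hq, by rw [inv_inv]; ring⟩
  have hX : AEMeasurable (fun ω : BondConfig (Site 3) =>
      ENNReal.ofReal (({v : Site 3 | v 0 = l ∧ ω ∈ openConnIn H 0 v}.ncard : ℝ) /
        ({v : Site 3 | v 0 = 0 ∧ ω ∈ openConnIn H 0 v}.ncard : ℝ))) μ :=
    (measurable_ratio l).aemeasurable
  have hg : AEMeasurable
      ({ω' : BondConfig (Site 3) | ∃ y : Site 3, y 0 = l ∧ ω' ∈ openConnIn H 0 y}.indicator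
        (1 : BondConfig (Site 3) → ℝ≥0∞)) μ :=
    (measurable_one.indicator (measurableSet_reach l)).aemeasurable
  calc ∫⁻ ω, ENNReal.ofReal (({v : Site 3 | v 0 = l ∧ ω ∈ openConnIn H 0 v}.ncard : ℝ) /
          ({v : Site 3 | v 0 = 0 ∧ ω ∈ openConnIn H 0 v}.ncard : ℝ)) ∂μ
      = ∫⁻ ω, ENNReal.ofReal (({v : Site 3 | v 0 = l ∧ ω ∈ openConnIn H 0 v}.ncard : ℝ) /
            ({v : Site 3 | v 0 = 0 ∧ ω ∈ openConnIn H 0 v}.ncard : ℝ)) *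
          {ω' : BondConfig (Site 3) | ∃ y : Site 3, y 0 = l ∧ ω' ∈ openConnIn H 0 y}.indicator
            (1 : BondConfig (Site 3) → ℝ≥0∞) ω ∂μ :=
        lintegral_congr fun ω => ratio_eq_ratio_mul_indicator l ω
    _ ≤ (∫⁻ ω, (ENNReal.ofReal (({v : Site 3 | v 0 = l ∧ ω ∈ openConnIn H 0 v}.ncard : ℝ) /
            ({v : Site 3 | v 0 = 0 ∧ ω ∈ openConnIn H 0 v}.ncard : ℝ))) ^ q ∂μ) ^ (1 / q) *
          (∫⁻ ω, ({ω' : BondConfig (Site 3) | ∃ y : Site 3, y 0 = l ∧ ω' ∈ openConnIn H 0 y}.indicator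
            (1 : BondConfig (Site 3) → ℝ≥0∞) ω) ^ ((1 - q⁻¹)⁻¹) ∂μ) ^ (1 / (1 - q⁻¹)⁻¹) :=
        ENNReal.lintegral_mul_le_Lp_mul_Lq μ hpq hX hg
    _ = (∫⁻ ω, ENNReal.ofReal ((({v : Site 3 | v 0 = l ∧ ω ∈ openConnIn H 0 v}.ncard : ℝ) /
            ({v : Site 3 | v 0 = 0 ∧ ω ∈ openConnIn H 0 v}.ncard : ℝ)) ^ q) ∂μ) ^ (1 / q) *
          (μ {ω' : BondConfig (Site 3) | ∃ y : Site 3, y 0 = l ∧ ω' ∈ openConnIn H 0 y}) ^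
            (1 - q⁻¹) := by
        have h1 : ∀ ω : BondConfig (Site 3),
            (ENNReal.ofReal (({v : Site 3 | v 0 = l ∧ ω ∈ openConnIn H 0 v}.ncard : ℝ) /
                ({v : Site 3 | v 0 = 0 ∧ ω ∈ openConnIn H 0 v}.ncard : ℝ))) ^ q =
              ENNReal.ofReal ((({v : Site 3 | v 0 = l ∧ ω ∈ openConnIn H 0 v}.ncard : ℝ) /
                ({v : Site 3 | v 0 = 0 ∧ ω ∈ openConnIn H 0 v}.ncard : ℝ)) ^ q) :=
          fun ω => ENNReal.ofReal_rpow_of_nonneg (by positivity) hq0.le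
        have h2 : ∀ ω : BondConfig (Site 3),
            ({ω' : BondConfig (Site 3) | ∃ y : Site 3, y 0 = l ∧ ω' ∈ openConnIn H 0 y}.indicator
                (1 : BondConfig (Site 3) → ℝ≥0∞) ω) ^ ((1 - q⁻¹)⁻¹) =
              {ω' : BondConfig (Site 3) | ∃ y : Site 3, y 0 = l ∧ ω' ∈ openConnIn H 0 y}.indicator
                1 ω :=
          fun ω => indicator_one_rpow _ (inv_pos.2 ha) ω
        rw [lintegral_congr h1, lintegral_congr h2, lintegral_indicator_one (measurableSet_reach l),
          one_div (1 - q⁻¹)⁻¹, inv_inv]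

end MomentGivesReciprocity

open MomentGivesReciprocity in
/-- **`SectionRatioMoment → ShadowReciprocity`** (item `stmt-CriticalPhenomena-5753`, exact
signature of `MomentGivesReciprocity`): a uniform bound `E_{p_c}[(D_t/W)^q] ≤ C` (`q > 1`,
`t ≥ 1`) gives `s_t ≤ max(C,0)^{1/q} · π_t^{1 - 1/q}` for all `t ≥ 1` — Hölder on the shadow
transport identity `s_t = E[(D_t/W)·𝟙{D_t ≥ 1}]` (`shadowTransport_proof`), `π_t = P(D_t ≥ 1)`.
[folklore] -/
theorem momentGivesReciprocity_proof : Theses.PercLayerChain.MomentGivesReciprocity := by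
  rintro ⟨q, C, hq, hmom⟩
  have hq0 : 0 < q := lt_trans zero_lt_one hq
  have ha : 0 < 1 - q⁻¹ := by
    have : q⁻¹ < 1 := inv_lt_one_of_one_lt₀ hq
    linarith
  refine ⟨1 - q⁻¹, ((ENNReal.ofReal C) ^ (1 / q)).toReal, ha, fun t ht => ?_⟩
  -- the shadow transport identity, in measure form
  have hT := shadowTransport_proof t
  rw [ofReal_measureReal] at hT
  -- Hölder
  have h1 := lintegral_ratio_le_holder (H := {x : Site 3 | 0 ≤ x 0})
    (bondPercolation (zdGraph 3) (criticalProbI 3)) (t : ℤ) hq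
  rw [hT] at h1
  have h2 : (∫⁻ ω, ENNReal.ofReal
        ((({v : Site 3 | v 0 = (t : ℤ) ∧ ω ∈ openConnIn {x : Site 3 | 0 ≤ x 0} 0 v}.ncard : ℝ) /
          ({v : Site 3 | v 0 = 0 ∧ ω ∈ openConnIn {x : Site 3 | 0 ≤ x 0} 0 v}.ncard : ℝ)) ^ q)
            ∂(bondPercolation (zdGraph 3) (criticalProbI 3))) ^ (1 / q) ≤
      (ENNReal.ofReal C) ^ (1 / q) :=
    ENNReal.rpow_le_rpow (hmom t ht) (by positivity)
  have h3 := h1.trans (mul_le_mul' h2 le_rfl)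
  -- back to real numbers
  have hne : (ENNReal.ofReal C) ^ (1 / q) *
      (bondPercolation (zdGraph 3) (criticalProbI 3)
        {ω' : BondConfig (Site 3) | ∃ y : Site 3, y 0 = (t : ℤ) ∧
          ω' ∈ openConnIn {x : Site 3 | 0 ≤ x 0} 0 y}) ^ (1 - q⁻¹) ≠ ⊤ :=
    ENNReal.mul_ne_top (ENNReal.rpow_ne_top_of_nonneg (by positivity) ENNReal.ofReal_ne_top)
      (ENNReal.rpow_ne_top_of_nonneg ha.le (measure_ne_top _ _))
  have h4 := ENNReal.toReal_mono hne h3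
  rw [ENNReal.toReal_mul, ← ENNReal.toReal_rpow _ (1 - q⁻¹)] at h4
  rw [measureReal_def, measureReal_def]
  exact h4

end Summit.CriticalPhenomena.PercolationContinuityZ3.Theorems

end
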